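import Summits.CriticalPhenomena.PercolationContinuityZ3.Theorems.PercNearOneGluingNoHeavyLowerTailThreePointProductFormPsiCone

/-!
# The box theorem, assembly layer: the AM form of the cycle with PHYSICAL (mixed-leaning) children as a Krein pairing,
# in the cone coordinates of LEMMA Λ and LEMMA ψ (Sahi programme, one-child boundary-star cycle, prover prim-sahi-p2 gen 67)

Support file (`--supports stmt-CriticalPhenomena-4575`).  Standard axioms, no sorries, no named facts.  Memo
`run/shared/lean/prim/prim-sahi/FROM-prim-sahi-p2-gen66-KREIN-STRUCTURE.md` §4, §9 and the gen-67 memo, `prim-sahi-p2/PROOF-E3.md` §76–§77.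

THE OBJECT.  The AM form `A = #P1 + #P2 − 2·#bad` of the cycle `a–y₁–…–y_k–a` with ONE boundary child `(u_t, w_t)` at every `y_t` is the
value of the 12-state normal-form series of `…ProductFormABPlus` at the PHYSICAL letters `θ_t = (s_t, d_t) = (u_t + w_t, u_t − w_t)`, i.e.
`|d_t| ≤ s_t`, acting by `s²·P + d²·Q + sd·R` (`bstepA` of `…ProductFormLeakDefs` on the `a`-part; `bstepB` below on the `b`-part):
`boxval θ = α_a(N_θ ω_a) + α_b(N_θ ω_b)`.  THEOREM AB+ (`coeff_nonneg`) gives `boxval ≥ 0` for same-leaning children (all `d_t ≥ 0`); the BOX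
THEOREM (conjecture (★) for this family, mixed leaning) is `boxval θ ≥ 0` for all physical words.  This file is its assembly layer:

* `kA_bstepA`, `kB_bstepB` — physical letters are `β`-selfadjoint for the Krein form of `…ProductFormKrein`; `brunA_append`, `kA_brunA`;
* ★ `boxval_append` — THE PHYSICAL PAIR IDENTITY `boxval (u ++ w) = β_a(state(reverse u), state(w)) + β_b(…)` (split the cycle word anywhere),
  `boxval_reverse`, and `boxval_append_coords` (tensor coordinates, verbatim as `coeff_append_coords`);
* ★ `boxval_append_cone` — the same identity in the CONE COORDINATES `G = −Λ − (7/30)t` (LEMMA Λ: `0 ≤ G` from depth 1, `leak_le`) and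
  `G_ψ = (3/20)t − ψ₂₃(m₋)` (LEMMA ψ: `0 ≤ G_ψ`, `psi_le`):
  `A[u++w] = (9/64)tt' + (135/112)(tG' + Gt') + (45/8)(tG_ψ' + G_ψt') + 12000[β𝕄(m₊,m'₋) + β𝕄(m₋,m'₊)] + 300β𝕄(m³,m'³) − 12εε'`;
* ★ `boxval_append_ge` — consequently, for NONEMPTY physical `u, w`:  `A[u++w] ≥ (9/64)tt' + ⟨m,m'⟩ − 12εε'`
  (`⟨m,m'⟩ = 12000[β𝕄(m₊,m'₋) + β𝕄(m₋,m'₊)] + 300β𝕄(m³,m'³)`), the form LEMMA Q must bound (gen-66 memo §5d/§9);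
* `boxval_nil`, `boxval_single` — the words of length `0` and `1` (`A[] = 0`, `A[θ] = 3d² ≥ 0`).
[this work] (gen 67).
-/

namespace Summit.CriticalPhenomena.PercolationContinuityZ3.Theorems.ProductFormABPlus

/-! ### 1. Physical letters on the `b`-part; the AM form of a physical word -/

/-- Componentwise linear combination `a·u + b·v + c·w` of three `b`-states. [this work] -/
def combB (a b c : ℚ) (u v w : StB) : StB :=
  ⟨a * u.E5 + b * v.E5 + c * w.E5, a * u.E4 + b * v.E4 + c * w.E4, a * u.f1 + b * v.f1 + c * w.f1, a * u.f2 + b * v.f2 + c * w.f2⟩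

/-- The physical letter `θ = (s,d)`: `s²·P + d²·Q + sd·R` on the `b`-part. [this work] -/
def bstepB (s d : ℚ) (v : StB) : StB := combB (s ^ 2) (d ^ 2) (s * d) (stepB .p v) (stepB .q v) (stepB .r v)

/-- A word of physical letters acting on a `b`-state (head letter acts last). [this work] -/
def brunB : List (ℚ × ℚ) → StB → StB
  | [], v => v
  | θ :: w, v => bstepB θ.1 θ.2 (brunB w v)

/-- The AM form `A = #P1 + #P2 − 2·#bad` of the one-child boundary-star cycle whose children are the physical letters `θ = (s_t,d_t)`:
the value of the 12-state normal-form series at `p_t = s_t², q_t = d_t², r_t = s_t d_t`. [this work] -/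
def boxval (w : List (ℚ × ℚ)) : ℚ := alphaA (brunA w omegaA) + alphaB (brunB w omegaB)

/-- A word is PHYSICAL when every letter `(s,d)` has `0 ≤ s + d` and `0 ≤ s − d` (the child `((s+d)/2, (s−d)/2)` is a pair of
nonnegative numbers); this file spells the condition out as `∀ θ ∈ w, 0 ≤ θ.1 + θ.2 ∧ 0 ≤ θ.1 - θ.2` (as `leak_le`, `psi_le` do).
The reverse of a physical word is physical. [this work] -/
theorem physical_reverse {w : List (ℚ × ℚ)} (hw : ∀ θ ∈ w, 0 ≤ θ.1 + θ.2 ∧ 0 ≤ θ.1 - θ.2) :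
    ∀ θ ∈ w.reverse, 0 ≤ θ.1 + θ.2 ∧ 0 ≤ θ.1 - θ.2 :=
  fun θ hθ => hw θ (List.mem_reverse.mp hθ)

/-- The two halves of a physical concatenation are physical. [this work] -/
theorem physical_append_iff {u w : List (ℚ × ℚ)} :
    (∀ θ ∈ u ++ w, 0 ≤ θ.1 + θ.2 ∧ 0 ≤ θ.1 - θ.2) ↔
      (∀ θ ∈ u, 0 ≤ θ.1 + θ.2 ∧ 0 ≤ θ.1 - θ.2) ∧ (∀ θ ∈ w, 0 ≤ θ.1 + θ.2 ∧ 0 ≤ θ.1 - θ.2) := by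
  constructor
  · intro h
    exact ⟨fun θ hθ => h θ (List.mem_append_left w hθ), fun θ hθ => h θ (List.mem_append_right u hθ)⟩
  · rintro ⟨hu, hw⟩ θ hθ
    rcases List.mem_append.mp hθ with h | h
    · exact hu θ h
    · exact hw θ h

/-! ### 2. Physical letters are `β`-selfadjoint; the physical pair identity -/

/-- Every physical letter is `β`-selfadjoint on the `a`-part. [this work] -/
theorem kA_bstepA (s d : ℚ) (v w : StA) : kA (bstepA s d v) w = kA v (bstepA s d w) := by
  simp only [kA, bstepA, combA, stepA]; ring

/-- Every physical letter is `β`-selfadjoint on the `b`-part. [this work] -/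
theorem kB_bstepB (s d : ℚ) (v w : StB) : kB (bstepB s d v) w = kB v (bstepB s d w) := by
  simp only [kB, bstepB, combB, stepB]; ring

/-- `N_{u ++ w} = N_u ∘ N_w` for physical words on the `a`-part. [this work] -/
theorem brunA_append (u w : List (ℚ × ℚ)) (v : StA) : brunA (u ++ w) v = brunA u (brunA w v) := by
  induction u with
  | nil => rfl
  | cons θ u ih => simp only [List.cons_append, brunA, ih]

/-- `N_{u ++ w} = N_u ∘ N_w` for physical words on the `b`-part. [this work] -/
theorem brunB_append (u w : List (ℚ × ℚ)) (v : StB) : brunB (u ++ w) v = brunB u (brunB w v) := by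
  induction u with
  | nil => rfl
  | cons θ u ih => simp only [List.cons_append, brunB, ih]

/-- Whole physical words are `β`-adjoint to their reversals (`a`-part). [this work] -/
theorem kA_brunA (u : List (ℚ × ℚ)) (v w : StA) : kA (brunA u v) w = kA v (brunA u.reverse w) := by
  induction u generalizing v w with
  | nil => rfl
  | cons θ u ih =>
    simp only [brunA, List.reverse_cons, brunA_append]
    rw [kA_bstepA, ih]

/-- Whole physical words are `β`-adjoint to their reversals (`b`-part). [this work] -/
theorem kB_brunB (u : List (ℚ × ℚ)) (v w : StB) : kB (brunB u v) w = kB v (brunB u.reverse w) := by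
  induction u generalizing v w with
  | nil => rfl
  | cons θ u ih =>
    simp only [brunB, List.reverse_cons, brunB_append]
    rw [kB_bstepB, ih]

/-- ★ THE PHYSICAL PAIR IDENTITY.  For all words `u, w` of letters `(s,d)`:
`A[u ++ w] = β_a(state(reverse u), state(w)) + β_b(state(reverse u), state(w))`. [this work] -/
theorem boxval_append (u w : List (ℚ × ℚ)) :
    boxval (u ++ w) = kA (brunA u.reverse omegaA) (brunA w omegaA) + kB (brunB u.reverse omegaB) (brunB w omegaB) := by
  unfold boxval
  rw [brunA_append, brunB_append, ← kA_omegaA, ← kB_omegaB, kA_symm, kA_brunA, kB_symm, kB_brunB]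
  rw [kA_symm, kB_symm]

/-- Reversal symmetry: `A[reverse w] = A[w]`. [this work] -/
theorem boxval_reverse (w : List (ℚ × ℚ)) : boxval w.reverse = boxval w := by
  have h := boxval_append w.reverse []
  rw [List.append_nil, List.reverse_reverse] at h
  rw [h]
  unfold boxval
  simp only [brunA, brunB]
  rw [kA_symm, kA_omegaA, kB_symm, kB_omegaB]

/-- The physical pair identity in tensor coordinates (as `coeff_append_coords`). [this work] -/
theorem boxval_append_coords (u w : List (ℚ × ℚ)) :
    boxval (u ++ w) =
      (81/64) * (brunA u.reverse omegaA).t * (brunA w omegaA).t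
      - (135/112) * ((brunA u.reverse omegaA).t * Lam (brunA w omegaA) + Lam (brunA u.reverse omegaA) * (brunA w omegaA).t)
      - (45/8) * ((brunA u.reverse omegaA).t * psi23 (colM (brunA w omegaA))
          + (brunA w omegaA).t * psi23 (colM (brunA u.reverse omegaA)))
      + 12000 * (betaM (colP (brunA u.reverse omegaA)) (colM (brunA w omegaA))
          + betaM (colM (brunA u.reverse omegaA)) (colP (brunA w omegaA)))
      + (300 * betaM (col3 (brunB u.reverse omegaB)) (col3 (brunB w omegaB))
          - 12 * (brunB u.reverse omegaB).E4 * (brunB w omegaB).E4) := by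
  rw [boxval_append, kA_coords, kB_coords]

/-! ### 3. The cone coordinates `G = −Λ − (7/30)t` (LEMMA Λ) and `G_ψ = (3/20)t − ψ₂₃(m₋)` (LEMMA ψ) -/

/-- The target coordinate of LEMMA ψ: `G_ψ(v) = (3/20)·t − ψ₂₃(m₋)`. [this work] -/
def Gpsi (v : StA) : ℚ := (3/20) * v.t - psi23 (colM v)

/-- `G_ψ` is the conjunct `G` of the cone `K_ψ` read through `zP`: `G_ψ(v) = (3/20)τ + (39/4)b − (23/4)b₋`. [this work] -/
theorem Gpsi_eq (v : StA) : Gpsi v = (3/20) * (zP v).τ + (39/4) * (zP v).b + (-23/4) * (zP v).bm := by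
  simp only [Gpsi, psi23, zP]; ring

/-- LEMMA ψ restated: `0 ≤ G_ψ` on every state reached by a physical word. [this work] -/
theorem Gpsi_nonneg (w : List (ℚ × ℚ)) (hw : ∀ θ ∈ w, 0 ≤ θ.1 + θ.2 ∧ 0 ≤ θ.1 - θ.2) : 0 ≤ Gpsi (brunA w omegaA) := by
  have h := psi_le w hw
  unfold Gpsi; linarith

/-- LEMMA Λ restated: `0 ≤ G = (zOf v).G` on every state reached by a NONEMPTY physical word. [this work] -/
theorem zOfG_nonneg (w : List (ℚ × ℚ)) (hw : ∀ θ ∈ w, 0 ≤ θ.1 + θ.2 ∧ 0 ≤ θ.1 - θ.2) (hne : w ≠ []) : 0 ≤ (zOf (brunA w omegaA)).G := by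
  have h := leak_le w hw hne
  simp only [zOf]; linarith

/-- The state coordinate `t` is nonnegative after every physical word (conjunct `L1` of `K_ψ`). [this work] -/
theorem t_brunA_nonneg (w : List (ℚ × ℚ)) (hw : ∀ θ ∈ w, 0 ≤ θ.1 + θ.2 ∧ 0 ≤ θ.1 - θ.2) : 0 ≤ (brunA w omegaA).t := by
  have h := (inKP_brun w hw).1
  simp only [zP, one_mul] at h
  exact h

/-- ★ THE PAIR IDENTITY IN CONE COORDINATES.  For all words `u, w`, with `v = state(reverse u)`, `v' = state(w)`, `G = (zOf ·).G`, `G_ψ = Gpsi`: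
`A[u++w] = (9/64)tt' + (135/112)(tG' + Gt') + (45/8)(tG_ψ' + G_ψt') + 12000[β𝕄(m₊,m'₋) + β𝕄(m₋,m'₊)] + 300β𝕄(m³,m'³) − 12εε'`
(the constant `9/64 = 81/64 + (135/56)(7/30) − (45/4)(3/20)`). [this work] -/
theorem boxval_append_cone (u w : List (ℚ × ℚ)) :
    boxval (u ++ w) =
      (9/64) * (brunA u.reverse omegaA).t * (brunA w omegaA).t
      + (135/112) * ((brunA u.reverse omegaA).t * (zOf (brunA w omegaA)).G
          + (zOf (brunA u.reverse omegaA)).G * (brunA w omegaA).t)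
      + (45/8) * ((brunA u.reverse omegaA).t * Gpsi (brunA w omegaA) + Gpsi (brunA u.reverse omegaA) * (brunA w omegaA).t)
      + 12000 * (betaM (colP (brunA u.reverse omegaA)) (colM (brunA w omegaA))
          + betaM (colM (brunA u.reverse omegaA)) (colP (brunA w omegaA)))
      + (300 * betaM (col3 (brunB u.reverse omegaB)) (col3 (brunB w omegaB))
          - 12 * (brunB u.reverse omegaB).E4 * (brunB w omegaB).E4) := by
  rw [boxval_append_coords]
  simp only [zOf, Gpsi]
  ring

/-- ★ Consequence of LEMMA Λ + LEMMA ψ (gen-66 memo §5d): for NONEMPTY physical words `u, w`,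
`A[u++w] ≥ (9/64)tt' + 12000[β𝕄(m₊,m'₋) + β𝕄(m₋,m'₊)] + 300β𝕄(m³,m'³) − 12εε'` — the inequality LEMMA Q has to finish. [this work] -/
theorem boxval_append_ge (u w : List (ℚ × ℚ)) (hu : ∀ θ ∈ u, 0 ≤ θ.1 + θ.2 ∧ 0 ≤ θ.1 - θ.2)
    (hw : ∀ θ ∈ w, 0 ≤ θ.1 + θ.2 ∧ 0 ≤ θ.1 - θ.2) (hune : u ≠ []) (hwne : w ≠ []) :
    (9/64) * (brunA u.reverse omegaA).t * (brunA w omegaA).t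
      + 12000 * (betaM (colP (brunA u.reverse omegaA)) (colM (brunA w omegaA))
          + betaM (colM (brunA u.reverse omegaA)) (colP (brunA w omegaA)))
      + (300 * betaM (col3 (brunB u.reverse omegaB)) (col3 (brunB w omegaB))
          - 12 * (brunB u.reverse omegaB).E4 * (brunB w omegaB).E4)
      ≤ boxval (u ++ w) := by
  rw [boxval_append_cone]
  have hur := physical_reverse hu
  have hurne : u.reverse ≠ [] := by simpa using hune
  have hG := zOfG_nonneg u.reverse hur hurne
  have hG' := zOfG_nonneg w hw hwne
  have hP := Gpsi_nonneg u.reverse hur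
  have hP' := Gpsi_nonneg w hw
  have ht := t_brunA_nonneg u.reverse hur
  have ht' := t_brunA_nonneg w hw
  nlinarith [mul_nonneg ht hG', mul_nonneg hG ht', mul_nonneg ht hP', mul_nonneg hP ht']

/-! ### 4. The two shortest words -/

/-- `A[] = 0` (the empty cycle word: `(27/8)(8/3) + 300/100 − 12 = 0`). [this work] -/
theorem boxval_nil : boxval [] = 0 := by
  simp only [boxval, brunA, brunB, omegaA, omegaB, alphaA, alphaB]; norm_num

/-- `A[θ] = 3·d²` for a single letter (`A[p] = A[r] = 0`, `A[q] = 3`). [this work] -/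
theorem boxval_single (s d : ℚ) : boxval [(s, d)] = 3 * d ^ 2 := by
  simp only [boxval, brunA, brunB, bstepA, bstepB, combA, combB, stepA, stepB, omegaA, omegaB, alphaA, alphaB]; ring

/-- `0 ≤ A[θ]` for every single letter. [this work] -/
theorem boxval_single_nonneg (θ : ℚ × ℚ) : 0 ≤ boxval [θ] := by
  rw [show [θ] = [(θ.1, θ.2)] from rfl, boxval_single]; positivity

end Summit.CriticalPhenomena.PercolationContinuityZ3.Theorems.ProductFormABPlus
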